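import Mathlib
import Summits.Ventures.PercRepro2.Defs
import Summits.Ventures.PercRepro2.Graph
import Summits.Ventures.PercRepro2.OneColourSwitch
import Summits.Ventures.PercRepro2.RegionHubSign
import Summits.Ventures.PercRepro2.SideSwitch
import Summits.Ventures.PercRepro2.SideSwitchFibre
import Summits.Ventures.PercRepro2.SideSwitchClosed
import Summits.Ventures.PercRepro2.SideSwitchComps
import Summits.Ventures.PercRepro2.M9NoPocketDefs
import Summits.Ventures.PercRepro2.M9NoPocketWorld
import Summits.Ventures.PercRepro2.M9NoPocketFibre
import Summits.Ventures.PercRepro2.M9NoPocketCompl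

/-!
# The block-group cube of the single-`d` family WITH a pocket — definitions (blind cell
PercRepro2, p3 g23, 2026-08-28; `proofs/P3-HARRIS.md` §3)

The switching cube of a representative `ρ` (every block of `G − d` on the `Y`-side, every
`T`-edge `Y`, every **pocket edge** — an edge inside the unexplored part `O′ ∪ {d}` of `G − d` —
`W`): the coordinate vector `x = (s, F)` switches the blocks of `s` and flips the free edges of
`F ⊆ Tset ∪ Pk ρ` (`assignX`, as landed).  This file has the pocket edges `Pk`, the free edges
`freeE`, the representatives `RepP`, the cube `cubeP`, the coordinates `coordsP` / `repP`, the
legal set `LegalP` (taken as a predicate: the assignments that are `Sep` and doubly reached only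
at `d`), and the worlds of `G − d` of an assignment: flipping free edges does not move them
(`K2_endsD_flipF_free`), so the worlds, the sided set, the blocks, the `W`-side and the pocket
of an assignment are those of the block switch (`K2_endsD_assignX'` … `Pk_assignX'`), and the
values of the `T`-edges and pocket edges of an assignment are read off `x.2` (`assignX_Pk`).
Own work; std axioms.
-/

namespace Summit.Ventures.PercRepro2

namespace NoPocket

open Finset Classical RegionHub OneColourSwitch SideSwitch

variable {V : Type*} {E : Type*}

section Defs

variable [Fintype V] [DecidableEq V] [Fintype E] [DecidableEq E]

variable (ends : E → Sym2 V)

/-- The pocket edges of a colouring: the edges inside the unexplored part `O′ ∪ {d}` of `G − d`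
(edges at `d` to pocket vertices and loops at `d` included). -/
noncomputable def Pk (d r s : V) (ρ : Config E) : Finset E :=
  univ.filter (fun e => e ∈ within ends (Oprime ends d r s ρ))

/-- The free edges of the cube: the `T`-edges and the pocket edges. -/
noncomputable def freeE (d r s : V) (ρ : Config E) : Finset E :=
  Tset ends d r s ∪ Pk ends d r s ρ

/-- The pocket representatives: representatives (`RepD`) with every pocket edge `W`. -/
noncomputable def RepP (p q r s d : V) : Finset (Config E) :=
  (RepD ends p q r s d).filter (fun ρ => ∀ e ∈ Pk ends d r s ρ, ρ e = false)

/-- The cube of a representative: sets of blocks × sets of free edges. -/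
noncomputable def cubeP (d r s : V) (ρ : Config E) : Finset (Finset (Finset V) × Finset E) :=
  (blocks ends d r s ρ).powerset ×ˢ (freeE ends d r s ρ).powerset

/-- The `Y`-coloured pocket edges of a colouring. -/
noncomputable def yPk (d r s : V) (ω : Config E) : Finset E :=
  (Pk ends d r s ω).filter (fun e => ω e = true)

/-- The coordinates of a colouring: its `B`-side blocks, its `W` `T`-edges and its `Y` pocket
edges. -/
noncomputable def coordsP (d r s : V) (ω : Config E) : Finset (Finset V) × Finset E :=
  ((blocks ends d r s ω).filter (fun C => C ⊆ Bside (endsD ends d) r s ω),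
    wT ends d r s ω ∪ yPk ends d r s ω)

/-- The representative of a colouring: every `B`-side block switched, every `W` `T`-edge and
every `Y` pocket edge flipped. -/
noncomputable def repP (d r s : V) (ω : Config E) : Config E :=
  flipTouch ends (↑(Bside (endsD ends d) r s ω) : Set V)
    (flipF (wT ends d r s ω ∪ yPk ends d r s ω) ω)

/-- The legal vectors of a representative: those whose assignment is `Sep` and doubly reached
only at `d`. -/
noncomputable def LegalP (p q r s d : V) (ρ : Config E) :
    Finset (Finset (Finset V) × Finset E) :=
  (cubeP ends d r s ρ).filter (fun x => assignX ends x ρ ∈ DOneSet ends p q r s d)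

variable {ends}

omit [Fintype V] [DecidableEq V] [DecidableEq E] in
/-- Membership in the pocket edges. -/
lemma mem_Pk {d r s : V} {ρ : Config E} {e : E} :
    e ∈ Pk ends d r s ρ ↔ e ∈ within ends (Oprime ends d r s ρ) := by
  simp [Pk]

omit [Fintype V] in
/-- Membership in the free edges. -/
lemma mem_freeE {d r s : V} {ρ : Config E} {e : E} :
    e ∈ freeE ends d r s ρ ↔ e ∈ Tset ends d r s ∨ e ∈ Pk ends d r s ρ := by
  simp [freeE]

/-- Membership in the pocket representatives. -/
lemma mem_RepP {p q r s d : V} {ρ : Config E} :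
    ρ ∈ RepP ends p q r s d ↔ ρ ∈ RepD ends p q r s d ∧ ∀ e ∈ Pk ends d r s ρ, ρ e = false := by
  simp [RepP]

/-- Membership in the cube. -/
lemma mem_cubeP {d r s : V} {ρ : Config E} {x : Finset (Finset V) × Finset E} :
    x ∈ cubeP ends d r s ρ ↔ x.1 ⊆ blocks ends d r s ρ ∧ x.2 ⊆ freeE ends d r s ρ := by
  simp [cubeP]

/-- Membership in the legal vectors. -/
lemma mem_LegalP {p q r s d : V} {ρ : Config E} {x : Finset (Finset V) × Finset E} :
    x ∈ LegalP ends p q r s d ρ ↔ x ∈ cubeP ends d r s ρ ∧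
      assignX ends x ρ ∈ DOneSet ends p q r s d := by
  simp [LegalP]

omit [Fintype V] [DecidableEq V] [DecidableEq E] in
/-- The pocket edges of the flipped colouring are the pocket edges. -/
lemma Pk_compl {d r s : V} (ρ : Config E) :
    Pk ends d r s (OneColourSwitch.compl ρ) = Pk ends d r s ρ := by
  simp only [Pk, Oprime_compl]

omit [Fintype V] in
/-- The free edges of the flipped colouring are the free edges. -/
lemma freeE_compl {d r s : V} (ρ : Config E) :
    freeE ends d r s (OneColourSwitch.compl ρ) = freeE ends d r s ρ := by
  simp only [freeE, Pk_compl]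

omit [Fintype V] [DecidableEq V] [DecidableEq E] in
/-- The `Y`-coloured pocket edges are pocket edges. -/
lemma yPk_subset {d r s : V} (ω : Config E) : yPk ends d r s ω ⊆ Pk ends d r s ω :=
  Finset.filter_subset _ _

omit [Fintype V] in
/-- The coordinates of a colouring are free edges of that colouring. -/
lemma coords_snd_subset_freeE {d r s : V} (ω : Config E) :
    wT ends d r s ω ∪ yPk ends d r s ω ⊆ freeE ends d r s ω :=
  Finset.union_subset_union (wT_subset ω) (yPk_subset ω)

omit [Fintype V] [DecidableEq E] in
/-- A pocket edge has both ends (in `G − d`) outside the worlds of `{r, s}`: it never touches the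
`Y`-world of `G − d`. -/
lemma Pk_not_touches_K2 {d r s : V} (hr : d ≠ r) (hs : d ≠ s) {ρ : Config E} {e : E}
    (he : e ∈ Pk ends d r s ρ) : e ∉ touches (endsD ends d) (K2 (endsD ends d) r s ρ) := by
  rintro ⟨y, hy, z, hyz⟩
  by_cases hd : d ∈ ends e
  · rw [endsD_of_mem hd, Sym2.eq_iff] at hyz
    rcases hyz with ⟨h1, _⟩ | ⟨_, h1⟩ <;> rw [← h1] at hy <;> exact not_mem_K2_endsD hr hs ρ hy
  · rw [endsD_of_notMem hd] at hyz
    exact not_mem_within_Oprime_of_mem_world hyz (Or.inl hy) (mem_Pk.1 he)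

omit [Fintype V] [DecidableEq E] in
/-- A `T`-edge never touches the `Y`-world of `G − d` (it is a loop at `d` there). -/
lemma Tset_not_touches_K2_endsD {d r s : V} (hr : d ≠ r) (hs : d ≠ s) (ρ : Config E) {e : E}
    (he : e ∈ Tset ends d r s) : e ∉ touches (endsD ends d) (K2 (endsD ends d) r s ρ) := by
  rintro ⟨y, hy, z, hyz⟩
  rw [endsD_of_mem (d_mem_of_mem_Tset he), Sym2.eq_iff] at hyz
  rcases hyz with ⟨h1, _⟩ | ⟨_, h1⟩ <;> rw [← h1] at hy <;> exact not_mem_K2_endsD hr hs ρ hy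

omit [Fintype V] in
/-- **Flipping free edges does not move the `Y`-world of `G − d`.** -/
lemma K2_endsD_flipF_free {d r s : V} (hr : d ≠ r) (hs : d ≠ s) {ρ : Config E} {F : Finset E}
    (hF : F ⊆ freeE ends d r s ρ) :
    K2 (endsD ends d) r s (flipF F ρ) = K2 (endsD ends d) r s ρ := by
  apply expl_eq_of_eqOn_touches
  intro e he
  have hnot : e ∉ F := by
    intro heF
    rcases mem_freeE.1 (hF heF) with hT | hP
    · exact Tset_not_touches_K2_endsD hr hs ρ hT he
    · exact Pk_not_touches_K2 hr hs hP he
  exact (flipF_of_notMem hnot).symm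

omit [Fintype V] in
/-- **Flipping free edges does not move the `W`-world of `G − d`.** -/
lemma M2_endsD_flipF_free {d r s : V} (hr : d ≠ r) (hs : d ≠ s) {ρ : Config E} {F : Finset E}
    (hF : F ⊆ freeE ends d r s ρ) :
    M2 (endsD ends d) r s (flipF F ρ) = M2 (endsD ends d) r s ρ := by
  rw [← K2_compl, ← K2_compl, compl_flipF]
  exact K2_endsD_flipF_free hr hs (by rwa [freeE_compl])

omit [Fintype V] in
/-- Flipping free edges does not move the unexplored part of `G − d`. -/
lemma Oprime_flipF_free {d r s : V} (hr : d ≠ r) (hs : d ≠ s) {ρ : Config E} {F : Finset E}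
    (hF : F ⊆ freeE ends d r s ρ) :
    Oprime ends d r s (flipF F ρ) = Oprime ends d r s ρ := by
  simp only [Oprime, Oset, K2_endsD_flipF_free hr hs hF, M2_endsD_flipF_free hr hs hF]

end Defs

section Assign

variable [Fintype V] [DecidableEq V] [Fintype E] [DecidableEq E]

variable {ends : E → Sym2 V}

/-- The unexplored part of `G − d` is preserved by a block switch. -/
lemma Oprime_flipTouch_endsD {p q r s d : V} {ρ : Config E} (hρ : ρ ∈ RepD ends p q r s d)
    {T : Finset (Finset V)} (hT : T ⊆ blocks ends d r s ρ) :
    Oprime ends d r s (flipTouch (endsD ends d) (↑(unionT T) : Set V) ρ) =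
      Oprime ends d r s ρ := by
  obtain ⟨h1, h2, h3, h4⟩ := block_switch_data hρ hT
  obtain ⟨hsep, _, _⟩ := mem_RepD.1 hρ
  simp only [Oprime, Oset]
  rw [U2_flipTouch_of_closed hsep h1 h2 h3 h4]

/-- The free edges are preserved by a block switch. -/
lemma freeE_flipTouch_endsD {p q r s d : V} {ρ : Config E} (hρ : ρ ∈ RepD ends p q r s d)
    {T : Finset (Finset V)} (hT : T ⊆ blocks ends d r s ρ) :
    freeE ends d r s (flipTouch (endsD ends d) (↑(unionT T) : Set V) ρ) =
      freeE ends d r s ρ := by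
  simp only [freeE, Pk, Oprime_flipTouch_endsD hρ hT]

omit [Fintype V] [Fintype E] in
/-- Off the edges at `d`, the assignment is the block switch of `G − d` applied to the flipped
representative. -/
lemma assignX_eq_flipTouch_endsD_flipF_of_notMem {d : V} {ρ : Config E}
    {x : Finset (Finset V) × Finset E} {e : E} (he : d ∉ ends e) :
    assignX ends x ρ e = flipTouch (endsD ends d) (↑(unionT x.1) : Set V) (flipF x.2 ρ) e := by
  simp only [assignX, flipTouch, mem_touches_endsD_iff he]

/-- **The `Y`-world of `G − d` of an assignment** is that of the block switch. -/
lemma K2_endsD_assignX_eq' {p q r s d : V} (hr : d ≠ r) (hs : d ≠ s) {ρ : Config E}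
    (hρ : ρ ∈ RepD ends p q r s d) {x : Finset (Finset V) × Finset E}
    (hT : x.1 ⊆ blocks ends d r s ρ) (hF : x.2 ⊆ freeE ends d r s ρ) :
    K2 (endsD ends d) r s (assignX ends x ρ) =
      K2 (endsD ends d) r s (flipTouch (endsD ends d) (↑(unionT x.1) : Set V) ρ) := by
  rw [K2_endsD_eq_of_eqOn (fun _ he => assignX_eq_flipTouch_endsD_flipF_of_notMem he) r s,
    ← flipF_flipTouch_comm]
  exact K2_endsD_flipF_free hr hs (by rwa [freeE_flipTouch_endsD hρ hT])

/-- **The `W`-world of `G − d` of an assignment** is that of the block switch. -/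
lemma M2_endsD_assignX_eq' {p q r s d : V} (hr : d ≠ r) (hs : d ≠ s) {ρ : Config E}
    (hρ : ρ ∈ RepD ends p q r s d) {x : Finset (Finset V) × Finset E}
    (hT : x.1 ⊆ blocks ends d r s ρ) (hF : x.2 ⊆ freeE ends d r s ρ) :
    M2 (endsD ends d) r s (assignX ends x ρ) =
      M2 (endsD ends d) r s (flipTouch (endsD ends d) (↑(unionT x.1) : Set V) ρ) := by
  rw [M2_endsD_eq_of_eqOn (fun _ he => assignX_eq_flipTouch_endsD_flipF_of_notMem he) r s,
    ← flipF_flipTouch_comm]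
  exact M2_endsD_flipF_free hr hs (by rwa [freeE_flipTouch_endsD hρ hT])

/-- The `Y`-world of `G − d` of an assignment: the `Y`-world of the representative minus the
switched blocks. -/
lemma K2_endsD_assignX' {p q r s d : V} (hr : d ≠ r) (hs : d ≠ s) {ρ : Config E}
    (hρ : ρ ∈ RepD ends p q r s d) {x : Finset (Finset V) × Finset E}
    (hT : x.1 ⊆ blocks ends d r s ρ) (hF : x.2 ⊆ freeE ends d r s ρ) :
    K2 (endsD ends d) r s (assignX ends x ρ) =
      K2 (endsD ends d) r s ρ \ (↑(unionT x.1) : Set V) := by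
  rw [K2_endsD_assignX_eq' hr hs hρ hT hF]
  obtain ⟨h1, h2, h3, h4⟩ := block_switch_data hρ hT
  obtain ⟨hsep, hM, _⟩ := mem_RepD.1 hρ
  rw [K2_flipTouch_of_closed hsep h1 h2 h3 h4]
  ext y
  simp only [Set.mem_union, Set.mem_sdiff, Set.mem_inter_iff]
  constructor
  · rintro (h | ⟨hyT, hyM⟩)
    · exact h
    · rcases hM y hyM with rfl | rfl
      · exact (h2 hyT).elim
      · exact (h3 hyT).elim
  · exact fun h => Or.inl h

/-- The `W`-world of `G − d` of an assignment: the switched blocks together with `r, s`. -/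
lemma M2_endsD_assignX' {p q r s d : V} (hr : d ≠ r) (hs : d ≠ s) {ρ : Config E}
    (hρ : ρ ∈ RepD ends p q r s d) {x : Finset (Finset V) × Finset E}
    (hT : x.1 ⊆ blocks ends d r s ρ) (hF : x.2 ⊆ freeE ends d r s ρ) :
    M2 (endsD ends d) r s (assignX ends x ρ) =
      M2 (endsD ends d) r s ρ ∪ (↑(unionT x.1) : Set V) := by
  rw [M2_endsD_assignX_eq' hr hs hρ hT hF]
  obtain ⟨h1, h2, h3, h4⟩ := block_switch_data hρ hT
  obtain ⟨hsep, _, _⟩ := mem_RepD.1 hρ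
  rw [M2_flipTouch_of_closed hsep h1 h2 h3 h4]
  have hK := unionT_subset_K2_endsD hρ hT
  ext y
  simp only [Set.mem_union, Set.mem_sdiff, Set.mem_inter_iff]
  constructor
  · rintro (⟨h, _⟩ | ⟨h, _⟩)
    · exact Or.inl h
    · exact Or.inr h
  · rintro (h | h)
    · by_cases hyT : y ∈ (↑(unionT x.1) : Set V)
      · exact Or.inr ⟨hyT, hK hyT⟩
      · exact Or.inl ⟨h, hyT⟩
    · exact Or.inr ⟨h, hK h⟩

/-- The unexplored part of `G − d` is preserved by an assignment. -/
lemma Oprime_assignX' {p q r s d : V} (hr : d ≠ r) (hs : d ≠ s) {ρ : Config E}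
    (hρ : ρ ∈ RepD ends p q r s d) {x : Finset (Finset V) × Finset E}
    (hT : x.1 ⊆ blocks ends d r s ρ) (hF : x.2 ⊆ freeE ends d r s ρ) :
    Oprime ends d r s (assignX ends x ρ) = Oprime ends d r s ρ := by
  simp only [Oprime, Oset]
  rw [K2_endsD_assignX_eq' hr hs hρ hT hF, M2_endsD_assignX_eq' hr hs hρ hT hF]
  obtain ⟨h1, h2, h3, h4⟩ := block_switch_data hρ hT
  obtain ⟨hsep, _, _⟩ := mem_RepD.1 hρ
  rw [U2_flipTouch_of_closed hsep h1 h2 h3 h4]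

/-- The pocket edges are preserved by an assignment. -/
lemma Pk_assignX' {p q r s d : V} (hr : d ≠ r) (hs : d ≠ s) {ρ : Config E}
    (hρ : ρ ∈ RepD ends p q r s d) {x : Finset (Finset V) × Finset E}
    (hT : x.1 ⊆ blocks ends d r s ρ) (hF : x.2 ⊆ freeE ends d r s ρ) :
    Pk ends d r s (assignX ends x ρ) = Pk ends d r s ρ := by
  simp only [Pk, Oprime_assignX' hr hs hρ hT hF]

/-- The free edges are preserved by an assignment. -/
lemma freeE_assignX' {p q r s d : V} (hr : d ≠ r) (hs : d ≠ s) {ρ : Config E}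
    (hρ : ρ ∈ RepD ends p q r s d) {x : Finset (Finset V) × Finset E}
    (hT : x.1 ⊆ blocks ends d r s ρ) (hF : x.2 ⊆ freeE ends d r s ρ) :
    freeE ends d r s (assignX ends x ρ) = freeE ends d r s ρ := by
  simp only [freeE, Pk_assignX' hr hs hρ hT hF]

/-- The sided set of `G − d` is preserved by an assignment. -/
lemma A0_endsD_assignX' {p q r s d : V} (hr : d ≠ r) (hs : d ≠ s) {ρ : Config E}
    (hρ : ρ ∈ RepD ends p q r s d) {x : Finset (Finset V) × Finset E}
    (hT : x.1 ⊆ blocks ends d r s ρ) (hF : x.2 ⊆ freeE ends d r s ρ) :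
    A0 (endsD ends d) r s (assignX ends x ρ) = A0 (endsD ends d) r s ρ := by
  ext y
  simp only [mem_A0]
  rw [K2_endsD_assignX' hr hs hρ hT hF, M2_endsD_assignX' hr hs hρ hT hF]
  have hK := unionT_subset_K2_endsD hρ hT
  constructor
  · rintro ⟨(⟨h, _⟩ | (h | h)), hr', hs'⟩
    · exact ⟨Or.inl h, hr', hs'⟩
    · exact ⟨Or.inr h, hr', hs'⟩
    · exact ⟨Or.inl (hK h), hr', hs'⟩
  · rintro ⟨(h | h), hr', hs'⟩
    · by_cases hyT : y ∈ (↑(unionT x.1) : Set V)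
      · exact ⟨Or.inr (Or.inr hyT), hr', hs'⟩
      · exact ⟨Or.inl ⟨h, hyT⟩, hr', hs'⟩
    · exact ⟨Or.inr (Or.inl h), hr', hs'⟩

/-- The blocks are preserved by an assignment. -/
lemma blocks_assignX' {p q r s d : V} (hr : d ≠ r) (hs : d ≠ s) {ρ : Config E}
    (hρ : ρ ∈ RepD ends p q r s d) {x : Finset (Finset V) × Finset E}
    (hT : x.1 ⊆ blocks ends d r s ρ) (hF : x.2 ⊆ freeE ends d r s ρ) :
    blocks ends d r s (assignX ends x ρ) = blocks ends d r s ρ := by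
  simp only [blocks, comps, A0_endsD_assignX' hr hs hρ hT hF]

/-- The `W`-side of `G − d` of an assignment is the switched union. -/
lemma Bside_endsD_assignX' {p q r s d : V} (hr : d ≠ r) (hs : d ≠ s) {ρ : Config E}
    (hρ : ρ ∈ RepD ends p q r s d) {x : Finset (Finset V) × Finset E}
    (hT : x.1 ⊆ blocks ends d r s ρ) (hF : x.2 ⊆ freeE ends d r s ρ) :
    Bside (endsD ends d) r s (assignX ends x ρ) = unionT x.1 := by
  obtain ⟨_, hM', _⟩ := mem_RepD.1 hρ
  ext y
  rw [mem_Bside, M2_endsD_assignX' hr hs hρ hT hF]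
  constructor
  · rintro ⟨(hyM | hyT), hyr, hys⟩
    · rcases hM' y hyM with h | h
      · exact (hyr h).elim
      · exact (hys h).elim
    · exact Finset.mem_coe.1 hyT
  · intro hyT
    have hyA := unionT_subset_A0 (ends := endsD ends d) hT hyT
    obtain ⟨_, hyr, hys⟩ := mem_A0.1 hyA
    exact ⟨Or.inr (Finset.mem_coe.2 hyT), hyr, hys⟩

/-- A pocket edge does not touch a union of blocks. -/
lemma Pk_not_touches_unionT {p q r s d : V} {ρ : Config E} (_hρ : ρ ∈ RepD ends p q r s d)
    {T : Finset (Finset V)} (hT : T ⊆ blocks ends d r s ρ) {e : E} (he : e ∈ Pk ends d r s ρ) :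
    e ∉ touches ends (↑(unionT T) : Set V) := by
  rintro ⟨y, hy, z, hyz⟩
  have hyA := unionT_subset_A0 (ends := endsD ends d) hT (Finset.mem_coe.1 hy)
  obtain ⟨hU, _, _⟩ := mem_A0.1 hyA
  exact not_mem_within_Oprime_of_mem_world hyz hU (mem_Pk.1 he)

/-- The value of a pocket edge in an assignment: flipped iff it is in `x.2`. -/
lemma assignX_Pk {p q r s d : V} {ρ : Config E} (hρ : ρ ∈ RepD ends p q r s d)
    {x : Finset (Finset V) × Finset E} (hT : x.1 ⊆ blocks ends d r s ρ) {e : E}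
    (he : e ∈ Pk ends d r s ρ) : assignX ends x ρ e = (if e ∈ x.2 then !ρ e else ρ e) := by
  simp only [assignX]
  rw [flipTouch_of_notMem ends (Pk_not_touches_unionT hρ hT he)]
  by_cases h : e ∈ x.2
  · rw [flipF_of_mem h, if_pos h]
  · rw [flipF_of_notMem h, if_neg h]

/-- The value of a free edge in an assignment: flipped iff it is in `x.2`. -/
lemma assignX_freeE {p q r s d : V} (hr : d ≠ r) (hs : d ≠ s) {ρ : Config E}
    (hρ : ρ ∈ RepD ends p q r s d) {x : Finset (Finset V) × Finset E}
    (hT : x.1 ⊆ blocks ends d r s ρ) {e : E} (he : e ∈ freeE ends d r s ρ) :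
    assignX ends x ρ e = (if e ∈ x.2 then !ρ e else ρ e) := by
  have h' := mem_freeE.1 he
  rcases h' with h | h
  · exact assignX_Tset hρ hT hr hs h
  · exact assignX_Pk hρ hT h

end Assign

end NoPocket

end Summit.Ventures.PercRepro2
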